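import Summits.QuantumFields.YangMills.Theorems.F4SubCurvatureDoorLaplaceFourier
import Mathlib
import HarnessLib

/-!
# Route `F4SubCurvatureDoor`, crux ⟨stmt-QuantumFields-23125⟩ `RationalToGeneral`: LINE g18-A v4 (planner `ym-idea-3` g18, tree
# `Cruxes/RationalToGeneral/Lines/sextic_channel.lean`) — registered stub S1 `stub_laplaceFourier` BY NAME AND SIGNATURE

The name-keyed statements of the skeleton (`E4`, `InClass`, `E3`, `timeSpace`, `IsLF`, `LaplaceFourier`) copied VERBATIM into this
file's own namespace, and `theorem stub_laplaceFourier : LaplaceFourier` proved by projection from the spelled-out tree theorem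
`F4SubCurvatureDoorGlobalReduction.laplaceFourier_of_class` (the budget and the lattice invariance conjuncts of `InClass` are not used).
Mathlib + tree; no `sorry`; standard axioms.  HONEST FRAMING: support stub S1 of an OPEN line; T1″ (the wall), `FischerNormalForm`,
`TopChannelCone`, crux 23125 / 23035, rung R2d and the summit are untouched; the Yang–Mills mass gap is NOT proved.
Width seat `ym-line-sfw-p2-w4` g20 (cell ym-idea-1, free hands). [cite: GlimmJaffeQP1987, §6.2]
-/

set_option autoImplicit false

noncomputable section

namespace Summit.QuantumFields.YangMills.Theorems.F4SubCurvatureDoorLaplaceFourierRegistered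

open scoped Topology BigOperators
open Filter Set MeasureTheory
open Literature.MathematicalPhysics.QuantumLattice (timeReflection siteToE)
open Summit.QuantumFields.YangMills.Cruxes.OSLegsAtWeakCouplingC.Sketch (IsSignedPerm)

/-- Euclidean `ℝ⁴` (verbatim from the skeleton). -/
abbrev E4 := EuclideanSpace ℝ (Fin 4)

/-- The hypotheses of C3 `GlobalShortRootRigidity`, bundled (verbatim from the skeleton). -/
def InClass (K : E4 → ℝ) : Prop :=
  ContinuousOn K {x | x ≠ 0} ∧
  (∃ C : ℝ, ∀ x, 1 ≤ ‖x‖ → |K x| ≤ C) ∧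
  (∀ R : E4 ≃ₗᵢ[ℝ] E4, IsSignedPerm R → ∀ x, K (R x) = K x) ∧
  (∀ (m : ℕ) (x : Fin m → E4) (c : Fin m → ℝ), (∀ i, 0 < x i 0) →
      0 ≤ ∑ i, ∑ j, c i * c j * K (timeReflection 4 (x i) - x j)) ∧
  Tendsto (fun x : E4 => ‖x‖ ^ 8 * K x) (𝓝[≠] 0) (𝓝 0) ∧
  (∀ R : E4 ≃ₗᵢ[ℝ] E4,
      (∀ z : Fin 4 → ℤ, Even (∑ i, z i) → ∃ w : Fin 4 → ℤ, Even (∑ i, w i) ∧ R (siteToE z) = siteToE w) →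
      ∀ x, K (R x) = K x)

/-- Euclidean `ℝ³` (space) (verbatim from the skeleton). -/
abbrev E3 := EuclideanSpace ℝ (Fin 3)

/-- The point `(t, z⃗) ∈ ℝ⁴` (verbatim from the skeleton). -/
noncomputable def timeSpace (t : ℝ) (z : E3) : E4 :=
  (WithLp.equiv 2 (Fin 4 → ℝ)).symm (Fin.cons t (fun j => z j))

/-- `μ` is a Laplace–Fourier measure of `K` (verbatim from the skeleton). -/
def IsLF (K : E4 → ℝ) (μ : Measure (ℝ × E3)) : Prop :=
  μ (Set.Iio 0 ×ˢ Set.univ) = 0 ∧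
  (∀ t : ℝ, 0 < t → Integrable (fun p : ℝ × E3 => Real.exp (-(t * p.1))) μ) ∧
  ∀ (t : ℝ) (z : E3), 0 < t →
    K (timeSpace t z) = ∫ p : ℝ × E3, Real.exp (-(t * p.1)) * Real.cos (inner ℝ p.2 z) ∂μ

/-- Stub S1 «LAPLACE–FOURIER MEASURE OF RP» (verbatim from the skeleton). -/
def LaplaceFourier : Prop :=
  ∀ K : E4 → ℝ, InClass K → ∃ μ : Measure (ℝ × E3), IsLF K μ

/-- **Registered stub S1 of LINE g18-A, BY NAME AND SIGNATURE**: every kernel of the C3 class has a Laplace–Fourier measure —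
projection from `F4SubCurvatureDoorGlobalReduction.laplaceFourier_of_class`. [cite: GlimmJaffeQP1987, §6.2] -/
theorem stub_laplaceFourier : LaplaceFourier := by
  intro K hK
  obtain ⟨μ, h0, hint, hrep⟩ :=
    Summit.QuantumFields.YangMills.Theorems.F4SubCurvatureDoorGlobalReduction.laplaceFourier_of_class K hK.1 hK.2.1
      hK.2.2.1 hK.2.2.2.1
  exact ⟨μ, h0, hint, fun t z ht => hrep t z ht⟩

end Summit.QuantumFields.YangMills.Theorems.F4SubCurvatureDoorLaplaceFourierRegistered

end
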